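import Summits.QuantumFields.BalabanUV.T4Continuum.Support.UrsellTermDecay

/-!
# NE5 ∕ U3 — convergence of the ORDERED series (2.13), part 5: the ANCHORED EXPONENTIAL NORM from the printed shapes
# (2.38) (activity bound), (1.26) (anchored tree-length sum) and (2.30) (volume ≤ tree length) — binder (i) in PRINTED FORM

Cell `pub-balaban`, unit `b2b-balaban-t4-ne5-formalise-leaf-08` (NE5 formalisation swarm, LEAF PROVER 08; row O1-d2 follower (iii);
parts 1–4 = `Support/UrsellTreeSum` p208810, `UrsellSeriesBound` p209076, `UrsellTermBudget` p209547 (+`Levels` p209760), `UrsellTermDecay`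
p209970).  Summits-side NEW WORK under the LEAN PLACEMENT RULE (cell bookkeeping).  HONEST FRAMING: rung (B)+1 of the FINITE-VOLUME T⁴
continuum programme — NOT infinite volume, NOT a mass gap, NOT the Clay problem, NOT a proof of NE5.  HONEST DEPENDENCY (cell line,
verbatim): continuum YM on T⁴ ⇐ BetaPertH ∧ nine spine estimates (0/9 proved); BetaPertH ⇐ (D1) ∧ (D4) ∧ CAP+tail; G-an2-4 gates asym,
D1 and NE2/3/4.

WHAT.  Parts 3–4 turn row O1-d3's `ClassBound` binder for the B13 family into a theorem modulo a nonnegative activity-term majorant whose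
ANCHORED EXPONENTIAL NORM `Σ_{Z ∈ level k, Z ∋ q} actSum(Z)·e^{#cubes Z} ≤ Φ` is small.  Print states the activity bound differently:
[Balaban1988RG2Cluster] Lemma 3 (2.38) p. 20 bounds the WHOLE activity, `|H(Z)| ≤ (const)·ε·exp(−κ d_k(Z))` (locator only; the SHAPE
`actSum(Z) ≤ ε·e^{−R d(Z)}` below), and the unit rate `e^{#cubes Z}` is paid from the tree's two displayed geometric shapes — the
anchored sum (1.26) p. 14 `B13FamilySum.Ineq126` (`Σ_{Y ∋ c} e^{−κ₀ d(Y)} ≤ K₀`) and the volume bound (2.30) p. 18 `B13FamilySum.VolBound`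
(`#cubes Y ≤ c₁(1 + d(Y))`) — exactly leaf-02-g2's INFO-4 (journal l.6897; the arithmetic of route P2's `kpInflated_b13`).  THIS FILE:
* `anchoredNorm_of_ineq126` — `w ≤ ε·e^{−R d}` on the step-`k` catalogue, `Ineq126 (level k) … κ₀ K₀`, `VolBound (level k) … c₁` and
  `κ₀ + c₁ ≤ R` ⟹ `Σ_{Z ∈ level k} 𝟙(q ∈ cubes Z)·w(Z)·e^{#cubes Z} ≤ ε·e^{c₁}·K₀` (every `q`);
* `actSum_strip_le` — stripping the rate `κ` off a (2.38)-shape majorant: `actSum(𝒜·e^{κ(d+c)})(Z) ≤ ε e^{κc}·e^{−(R−κ)d(Z)}`;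
* **`classBound_b13_of_printedShapes`** — for a step model whose output is the B13 series on Bałaban's term labels: a displayed termwise
  activity majorant `𝒜` at the class points with (2.38)-shape level sums `actSum(𝒜 k g U)(Z) ≤ ε·e^{−R d(Z)}`, the displayed (1.26),
  (2.30), (2.27) shapes on every step catalogue, a footprint-local reach `ν`, the rate split `κ + κ₀ + c₁ ≤ R` and the SMALLNESS
  `4ν·(ε e^{κc} e^{c₁} K₀) < 1` ⟹ `ClassBound M K W κ (Φ′/(1 − 4νΦ′))`, `Φ′ = ε e^{κc} e^{c₁} K₀` (parts 3–4 BY NAME);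
  `termRep_b13_of_printedShapes` — the `TermRep` half from (2.38)-shape, (1.26), (2.30) alone (`Φ = ε e^{c₁} K₀`).
Nothing of [I]∕[II] is asserted: (2.38), (1.26), (2.30), (2.27) enter as HYPOTHESES of the printed kind (the last three are the tree's
cited `B13FamilySum` shapes).  No definitions; 0 sorry; axioms ⊆ {propext, Classical.choice, Quot.sound}.
-/

noncomputable section

open Finset
open scoped BigOperators

namespace Summit.QuantumFields.BalabanUV.T4Continuum.UrsellActivityNorm

open Literature.MathematicalPhysics.QuantumFieldTheory.Balaban1983to89.T4OutputRate (Carriers)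
open Literature.MathematicalPhysics.QuantumFieldTheory.Balaban1983to89.T4InputCauchyRateData (StepModel)
open Literature.MathematicalPhysics.QuantumFieldTheory.Balaban1983to89.T4InputCauchyRateSpecies (ClassBound)
open Literature.MathematicalPhysics.QuantumFieldTheory.Balaban1983to89.T4InputCauchyRateTermwise (TermRep)
open Literature.MathematicalPhysics.QuantumFieldTheory.Balaban1983to89.B13FamilySum (Ineq126 VolBound Ineq227)
open Summit.QuantumFields.BalabanUV.T4Continuum.ClusterRepOfDomains (DomainGeometry)
open Summit.QuantumFields.BalabanUV.T4Continuum.B13StepTermFamily (out)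
open Summit.QuantumFields.BalabanUV.T4Continuum.B13StepTermLabels
open Summit.QuantumFields.BalabanUV.T4Continuum.B13StepTermSocket (labelsIndexing touchInc)
open Summit.QuantumFields.BalabanUV.T4Continuum.UrsellTreeSum (ind ind_nonneg ind_of_pos ind_of_neg)
open Summit.QuantumFields.BalabanUV.T4Continuum.UrsellTermBudget (actSum actSum_nonneg termRep_b13_of_actNorm)
open Summit.QuantumFields.BalabanUV.T4Continuum.UrsellTermDecay (classBound_b13_of_actNormDecay)

variable {C : Carriers} [DecidableEq C.Dom] {Cube : Type*} [DecidableEq Cube] {Bnd : Type*} [DecidableEq Bnd]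
  (G : DomainGeometry C Cube) (D : InnerData C Bnd)

/-! ## §1 The anchored exponential norm from (2.38)-shape decay, (1.26) and (2.30) -/

/-- [folklore] ONE POLYMER: `w(Z) ≤ ε e^{−R d(Z)}` and `#cubes Z ≤ c₁(1 + d(Z))` with `κ₀ + c₁ ≤ R` give `w(Z)·e^{#cubes Z} ≤ ε e^{c₁}·e^{−κ₀ d(Z)}`. -/
theorem weight_mul_exp_card_le {Z : C.Dom} {w ε R κ₀ c₁ : ℝ} (hε : 0 ≤ ε) (hw : w ≤ ε * Real.exp (-(R * C.d Z)))
    (hvol : ((G.cubes Z).card : ℝ) ≤ c₁ * (1 + C.d Z)) (hR : κ₀ + c₁ ≤ R) :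
    w * Real.exp ((G.cubes Z).card) ≤ ε * Real.exp c₁ * Real.exp (-(κ₀ * C.d Z)) :=
  calc w * Real.exp ((G.cubes Z).card) ≤ ε * Real.exp (-(R * C.d Z)) * Real.exp (c₁ * (1 + C.d Z)) :=
        mul_le_mul hw (Real.exp_le_exp.2 hvol) (Real.exp_pos _).le (mul_nonneg hε (Real.exp_pos _).le)
    _ = ε * Real.exp (-(R * C.d Z) + c₁ * (1 + C.d Z)) := by rw [mul_assoc, ← Real.exp_add]
    _ ≤ ε * Real.exp (c₁ + -(κ₀ * C.d Z)) :=
        mul_le_mul_of_nonneg_left (Real.exp_le_exp.2 (by nlinarith [mul_nonneg (sub_nonneg.2 hR) (C.d_nonneg Z)])) hε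
    _ = ε * Real.exp c₁ * Real.exp (-(κ₀ * C.d Z)) := by rw [Real.exp_add, mul_assoc]

/-- [folklore] **THE ANCHORED EXPONENTIAL NORM FROM THE PRINTED SHAPES**: on the step-`k` catalogue, a nonnegative polymer weight with
(2.38)-shape decay `w(Z) ≤ ε e^{−R d(Z)}`, the anchored sum (1.26) `Ineq126 (level k) cubes d κ₀ K₀` and the volume bound (2.30)
`VolBound (level k) cubes d c₁` with `κ₀ + c₁ ≤ R` give `Σ_{Z ∈ level k} 𝟙(q ∈ cubes Z)·w(Z)·e^{#cubes Z} ≤ ε e^{c₁} K₀` for every cube `q`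
— hypothesis `hΦ` of parts 3–4 with `Φ = ε e^{c₁} K₀`. -/
theorem anchoredNorm_of_ineq126 {k : ℕ} {w : C.Dom → ℝ} {ε R κ₀ K₀ c₁ : ℝ} (hε : 0 ≤ ε)
    (hw : ∀ Z ∈ G.level k, w Z ≤ ε * Real.exp (-(R * C.d Z))) (h126 : Ineq126 (G.level k) G.cubes C.d κ₀ K₀)
    (hvol : VolBound (G.level k) G.cubes C.d c₁) (hR : κ₀ + c₁ ≤ R) (q : Cube) :
    ∑ Z ∈ G.level k, ind (q ∈ G.cubes Z) * w Z * Real.exp ((G.cubes Z).card) ≤ ε * Real.exp c₁ * K₀ := by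
  have hterm : ∀ Z ∈ G.level k, ind (q ∈ G.cubes Z) * w Z * Real.exp ((G.cubes Z).card) ≤
      ε * Real.exp c₁ * (ind (q ∈ G.cubes Z) * Real.exp (-(κ₀ * C.d Z))) := fun Z hZ =>
    calc ind (q ∈ G.cubes Z) * w Z * Real.exp ((G.cubes Z).card) = ind (q ∈ G.cubes Z) * (w Z * Real.exp ((G.cubes Z).card)) :=
          mul_assoc _ _ _
      _ ≤ ind (q ∈ G.cubes Z) * (ε * Real.exp c₁ * Real.exp (-(κ₀ * C.d Z))) :=
          mul_le_mul_of_nonneg_left (weight_mul_exp_card_le G hε (hw Z hZ) (hvol Z hZ) hR) (ind_nonneg _)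
      _ = ε * Real.exp c₁ * (ind (q ∈ G.cubes Z) * Real.exp (-(κ₀ * C.d Z))) := by ring
  have hind : ∑ Z ∈ G.level k, ind (q ∈ G.cubes Z) * Real.exp (-(κ₀ * C.d Z)) =
      ∑ Z ∈ (G.level k).filter (fun Z => q ∈ G.cubes Z), Real.exp (-(κ₀ * C.d Z)) := by
    rw [sum_filter]
    refine sum_congr rfl fun Z _ => ?_
    by_cases h : q ∈ G.cubes Z
    · rw [if_pos h, ind_of_pos h, one_mul]
    · rw [if_neg h, ind_of_neg h, zero_mul]
  calc ∑ Z ∈ G.level k, ind (q ∈ G.cubes Z) * w Z * Real.exp ((G.cubes Z).card)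
      ≤ ∑ Z ∈ G.level k, ε * Real.exp c₁ * (ind (q ∈ G.cubes Z) * Real.exp (-(κ₀ * C.d Z))) := sum_le_sum hterm
    _ = ε * Real.exp c₁ * ∑ Z ∈ (G.level k).filter (fun Z => q ∈ G.cubes Z), Real.exp (-(κ₀ * C.d Z)) := by
        rw [← mul_sum, hind]
    _ ≤ ε * Real.exp c₁ * K₀ := mul_le_mul_of_nonneg_left (h126 q) (mul_nonneg hε (Real.exp_pos _).le)

/-! ## §2 Stripping the rate off a (2.38)-shape majorant -/

omit [DecidableEq Cube] in
/-- [folklore] The level sum of the STRIPPED majorant `𝒜′ Z ℓ := 𝒜 Z ℓ · e^{κ(d(Z)+c)}` is the level sum of `𝒜` times `e^{κ(d(Z)+c)}`. -/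
theorem actSum_strip (A : C.Dom → InnerLabel C.Dom Bnd → ℝ) (κ c : ℝ) (k : ℕ) (Z : C.Dom) :
    actSum D (fun Z ℓ => A Z ℓ * Real.exp (κ * (C.d Z + c))) k Z = actSum D A k Z * Real.exp (κ * (C.d Z + c)) := by
  unfold actSum
  rw [sum_mul]

omit [DecidableEq Cube] in
/-- [folklore] A (2.38)-shape level bound `actSum(𝒜)(Z) ≤ ε e^{−R d(Z)}` gives for the stripped majorant `actSum(𝒜′)(Z) ≤ (ε e^{κc})·e^{−(R−κ) d(Z)}`. -/
theorem actSum_strip_le {A : C.Dom → InnerLabel C.Dom Bnd → ℝ} {κ c ε R : ℝ} {k : ℕ} {Z : C.Dom}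
    (h238 : actSum D A k Z ≤ ε * Real.exp (-(R * C.d Z))) :
    actSum D (fun Z ℓ => A Z ℓ * Real.exp (κ * (C.d Z + c))) k Z ≤ ε * Real.exp (κ * c) * Real.exp (-((R - κ) * C.d Z)) := by
  rw [actSum_strip]
  calc actSum D A k Z * Real.exp (κ * (C.d Z + c)) ≤ ε * Real.exp (-(R * C.d Z)) * Real.exp (κ * (C.d Z + c)) :=
        mul_le_mul_of_nonneg_right h238 (Real.exp_pos _).le
    _ = ε * Real.exp (κ * c) * Real.exp (-((R - κ) * C.d Z)) := by
        rw [mul_assoc, mul_assoc, ← Real.exp_add, ← Real.exp_add]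
        ring_nf

/-! ## §3 The payoff: `ClassBound` with rate for the B13 family on the socket, from the printed shapes -/

variable {Op Hist : Type*} [NormedAddCommGroup Op] [NormedSpace ℂ Op] [NormedAddCommGroup Hist] [NormedSpace ℂ Hist]

/-- [folklore] **ROW O1-d3's `ClassBound` BINDER FOR THE B13 FAMILY, FROM THE PRINTED SHAPES** — for a step model whose output is the B13
series on Bałaban's term labels (`M.Out = out (labelsIndexing G D) (touchInc G) act`; for the assembled step of record `hM := rfl`):
(i) a displayed nonnegative termwise activity majorant `𝒜 k g U` at the class points whose level sums have the (2.38) SHAPE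
`actSum(𝒜 k g U)(Z) ≤ ε·e^{−R d(Z)}` on every step catalogue ([Balaban1988RG2Cluster] Lemma 3 (2.38) p. 20 — locator only);
(ii) the displayed geometric shapes of the tree's `B13FamilySum` on every step catalogue — (1.26) `Ineq126 … κ₀ K₀`, (2.30) `VolBound … c₁`,
(2.27) `Ineq227 … c` — and a footprint-local reach `ν` (`B13Resummation.kp_condition` shape); (iii) the rate split `κ + κ₀ + c₁ ≤ R` and the
SMALLNESS `4ν·Φ′ < 1`, `Φ′ = ε e^{κc} e^{c₁} K₀` ⟹ **`ClassBound M K W κ (Φ′/(1 − 4νΦ′))`** (parts 3–4: `UrsellTermDecay.classBound_b13_of_actNormDecay`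
on the stripped majorant `𝒜·e^{κ(d+c)}`, whose anchored exponential norm is `≤ Φ′` by §1–§2).  Nothing of [I]∕[II] is asserted. -/
theorem classBound_b13_of_printedShapes (act : C.Dom → InnerLabel C.Dom Bnd → Op → Hist → ℂ) {M : StepModel C Op Hist}
    (hM : ∀ k o h X, M.Out k o h X = out (labelsIndexing G D) (touchInc G) act k o h X)
    {K : ℕ → (ℕ → ℝ) → C.BgB → Set (Op × Hist)} {W : Set (ℕ → ℝ)} {𝒜 : ℕ → (ℕ → ℝ) → C.BgB → C.Dom → InnerLabel C.Dom Bnd → ℝ}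
    {ε R κ κ₀ K₀ c₁ c ν : ℝ} (hε : 0 ≤ ε) (hκ : 0 ≤ κ) (hc : 0 ≤ c) (hK₀ : 0 ≤ K₀) (hν : 0 ≤ ν) (hR : κ + κ₀ + c₁ ≤ R)
    (hsmall : 4 * ν * (ε * Real.exp (κ * c) * Real.exp c₁ * K₀) < 1)
    (hA : ∀ k, ∀ g ∈ W, ∀ (U : C.BgB) (q : Op × Hist), q ∈ K k g U → ∀ X : C.Dom, C.scale X = k →
      ∀ i : TermIdx C.Dom Bnd, (labelsIndexing G D).Rel k i X →
        ∀ m, ‖act ((labelsIndexing G D).poly i m) ((labelsIndexing G D).lab i m) q.1 q.2‖ ≤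
          𝒜 k g U ((labelsIndexing G D).poly i m) ((labelsIndexing G D).lab i m))
    (hA0 : ∀ k g U Z ℓ, 0 ≤ 𝒜 k g U Z ℓ)
    (h238 : ∀ k, ∀ g ∈ W, ∀ (U : C.BgB), ∀ Z ∈ G.level k, actSum D (𝒜 k g U) k Z ≤ ε * Real.exp (-(R * C.d Z)))
    (h126 : ∀ k, Ineq126 (G.level k) G.cubes C.d κ₀ K₀) (hvol : ∀ k, VolBound (G.level k) G.cubes C.d c₁)
    (h227 : ∀ X : C.Dom, Ineq227 (G.level (C.scale X)) G.cubes C.d (G.cubes X) (C.d X) c)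
    (reach : C.Dom → Finset Cube) (hloc : ∀ Z Z', touchInc G Z' Z → ∃ q ∈ reach Z, q ∈ G.cubes Z')
    (hreach : ∀ Z, ((reach Z).card : ℝ) ≤ ν * (G.cubes Z).card) :
    ClassBound M K W κ ((ε * Real.exp (κ * c) * Real.exp c₁ * K₀) / (1 - 4 * ν * (ε * Real.exp (κ * c) * Real.exp c₁ * K₀))) := by
  refine classBound_b13_of_actNormDecay G D act hM (𝒜' := fun k g U Z ℓ => 𝒜 k g U Z ℓ * Real.exp (κ * (C.d Z + c))) hκ hc hA hA0
    (fun k g U Z ℓ => mul_nonneg (hA0 k g U Z ℓ) (Real.exp_pos _).le) (fun k g U Z ℓ => le_of_eq ?_) h227 reach hloc hν hreach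
    (mul_nonneg (mul_nonneg (mul_nonneg hε (Real.exp_pos _).le) (Real.exp_pos _).le) hK₀) hsmall fun k g hg U q => ?_
  · rw [mul_assoc, ← Real.exp_add, add_neg_cancel, Real.exp_zero, mul_one]
  · have hR' : κ₀ + c₁ ≤ R - κ := by linarith
    exact anchoredNorm_of_ineq126 G (mul_nonneg hε (Real.exp_pos _).le)
      (fun Z hZ => actSum_strip_le D (h238 k g hg U Z hZ)) (h126 k) (hvol k) hR' q

/-- [folklore] **ROW O1-d3's `TermRep` FOR THE B13 FAMILY, FROM THE PRINTED SHAPES** (no rate needed): the displayed termwise activity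
majorant with (2.38)-shape level sums, (1.26), (2.30), a footprint-local reach, `κ₀ + c₁ ≤ R` and `4ν·(ε e^{c₁} K₀) < 1` ⟹
`TermRep M K (term (labelsIndexing G D) (touchInc G) act) W` (part 3's `termRep_b13_of_actNorm` with `hΦ := anchoredNorm_of_ineq126`). -/
theorem termRep_b13_of_printedShapes (act : C.Dom → InnerLabel C.Dom Bnd → Op → Hist → ℂ) {M : StepModel C Op Hist}
    (hM : ∀ k o h X, M.Out k o h X = out (labelsIndexing G D) (touchInc G) act k o h X)
    {K : ℕ → (ℕ → ℝ) → C.BgB → Set (Op × Hist)} {W : Set (ℕ → ℝ)} {𝒜 : ℕ → (ℕ → ℝ) → C.BgB → C.Dom → InnerLabel C.Dom Bnd → ℝ}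
    {ε R κ₀ K₀ c₁ ν : ℝ} (hε : 0 ≤ ε) (hK₀ : 0 ≤ K₀) (hν : 0 ≤ ν) (hR : κ₀ + c₁ ≤ R) (hsmall : 4 * ν * (ε * Real.exp c₁ * K₀) < 1)
    (hA : ∀ k, ∀ g ∈ W, ∀ (U : C.BgB) (q : Op × Hist), q ∈ K k g U → ∀ X : C.Dom, C.scale X = k →
      ∀ i : TermIdx C.Dom Bnd, (labelsIndexing G D).Rel k i X →
        ∀ m, ‖act ((labelsIndexing G D).poly i m) ((labelsIndexing G D).lab i m) q.1 q.2‖ ≤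
          𝒜 k g U ((labelsIndexing G D).poly i m) ((labelsIndexing G D).lab i m))
    (hA0 : ∀ k g U Z ℓ, 0 ≤ 𝒜 k g U Z ℓ)
    (h238 : ∀ k, ∀ g ∈ W, ∀ (U : C.BgB), ∀ Z ∈ G.level k, actSum D (𝒜 k g U) k Z ≤ ε * Real.exp (-(R * C.d Z)))
    (h126 : ∀ k, Ineq126 (G.level k) G.cubes C.d κ₀ K₀) (hvol : ∀ k, VolBound (G.level k) G.cubes C.d c₁)
    (reach : C.Dom → Finset Cube) (hloc : ∀ Z Z', touchInc G Z' Z → ∃ q ∈ reach Z, q ∈ G.cubes Z')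
    (hreach : ∀ Z, ((reach Z).card : ℝ) ≤ ν * (G.cubes Z).card) :
    TermRep M K (B13StepTermFamily.term (labelsIndexing G D) (touchInc G) act) W :=
  termRep_b13_of_actNorm G D act hM hA hA0 reach hloc hν hreach (mul_nonneg (mul_nonneg hε (Real.exp_pos _).le) hK₀) hsmall
    fun k g hg U q => anchoredNorm_of_ineq126 G hε (h238 k g hg U) (h126 k) (hvol k) hR q

end Summit.QuantumFields.BalabanUV.T4Continuum.UrsellActivityNorm

end
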